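import Literature.MathematicalPhysics.QuantumFieldTheory.Balaban1983to89.B9Thm37GlueLevelSumOsc
import Literature.MathematicalPhysics.QuantumFieldTheory.Balaban1983to89.B9Thm37GluePU

/-!
# `Balaban1983to89.B9Thm37GlueTowerEntriesTorus` — entries 1, 2, 3 of (3.42) for G′ IN THE TORUS MODEL of [3] (1.118) with the
# AVERAGING PART OF Δ′_a THE TOWER'S MULTI-LEVEL Q′\*aQ′ = Σ_{l≤k} a_lG_lᵀG_l and its Q-binders DISCHARGED (the torus twins that
# `B9Thm37GluePU` gives for entry 4 only — `thm37_entry4_torus` ∕ `B9Thm37GlueTowerEntry4.thm37_entry4_torusTower`; cell `pub-ymgap`,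
# Track A node N06 [B9] second -b seat dag-n19-b, dag-lead's word l.9643; count-neutral MODEL bookkeeping)

References (bib keys): [B9] = `Balaban1985BackgroundPropagators`; [4] = `Balaban1984PropagatorsII`; [3] = `Balaban1984PropagatorsI` —
only NAMED, loci certified in the headers of `B9Thm37GluePU` ∕ `B9Thm37GlueSz` ∕ `B9Thm37GlueLevelSumComm`.

THE POINT.  `B9Thm37GlueSz.thm37_entry{1,2,3}_of_342_lattice_of_387_sz` on the torus `UT N`: the partition-of-unity binders
(`hh`, `hsq`, `hθ0 hθ hθ₂0 hθ₂` with θ = 4|c₀|d∕M₀, θ₂ = 52c₀²d∕M₀², bond counts `hNs hNt` = d) are discharged by `B9Thm37GluePU` §1–§3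
exactly as in its `thm37_entry4_torus`, AND the averaging part is the tower's level sum with its Q-binders discharged by
`B9Thm37GlueLevelSumOsc.commData_towerLevelSum_of_bondBound` (entry 3's symmetry `hQt` by `isTransposePair_levelSum`).  Every other
hypothesis verbatim from the lineage — NOT asserted.

HONEST SCOPE.  As `B9Thm37GluePU` + `B9Thm37GlueLevelSumComm`: component MODEL; nothing of print asserted; NOT a node discharge;
NOT continuum, NOT Clay.
-/

namespace Literature.MathematicalPhysics.QuantumFieldTheory.Balaban1983to89.B9Thm37GlueTowerEntriesTorus

open Literature.MathematicalPhysics.QuantumFieldTheory.Balaban1983to89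
open Finset B6RandomWalk B6RandomWalkHom B9Thm37Sum B9Thm34Ext B9Thm37Glue B9Thm37GlueT B9Thm37GlueSt B9Thm37GlueSz
  B9Thm37GlueTorusCov B9Thm37GlueTorusCovComp B9Thm37GlueTorusCovLevels B9Thm37GlueTorusCovTower B9Thm37GluePU
  B9Thm37GlueLevelSumComm B9Thm37GlueLevelSumOsc

noncomputable section

variable {d : ℕ} {N : Fin d → ℕ} [∀ i, NeZero (N i)] [NeZero d] {g : B9.Geometry} [Fintype g.Site] [DecidableEq g.Site]
  {R : ℝ} {H : Prop} {Cp : Type}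

/-- **THEOREM 3.7 ⇒ ENTRY 1 OF (3.42) (sup entry of G′), TORUS MODEL OF [3] (1.118), WITH THE TOWER'S MULTI-LEVEL Q′\*aQ′ AND ITS Q-BINDERS DISCHARGED**
= `B9Thm37GlueSz.thm37_entry1_of_342_lattice_of_387_sz` on the torus `UT N` (partition `hSU N M₀`, nearest-neighbour bonds with weight c₀, the ∂h∕Δh sizes
`4|c₀|d∕M₀`, `52c₀²d∕M₀²`, bond counts d, Σ_z h_z² = 1 — `B9Thm37GluePU` §1–§3) at `Qf := Σ_{l≤k} a_lG_lᵀG_l` over the cube-comb tower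
`torusTower` (sides M_j), the Q-binders supplied by `B9Thm37GlueLevelSumOsc.commData_towerLevelSum_of_bondBound` (θ = 4d∕M₀, D_j = d(M_j − 1),
n_j = M_j^d), κ_Q := Σ_l (2(Σ_{j<l} d(M_j − 1))·4d∕M₀)·k_l; newly displayed binders `hW hkk hk hnestTop hS'Q`; every other hypothesis
verbatim from the lineage (NOT asserted). [cite: Balaban1985BackgroundPropagators, Thm 3.7 (3.87)–(3.90) pp.408–410 + (3.42) p.397 + (3.16) p.393; Balaban1984PropagatorsII, (2.40)–(2.44) p.230; Balaban1984PropagatorsI, (1.118) p.36] -/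
theorem thm37_entry1_torusTower [Fintype Cp]
    [DecidableEq Cp]
    {M₀ : ℕ} (hM : 1 ≤ M₀) (hdiv : ∀ i, M₀ ∣ N i) (h2N : ∀ i, 2 * M₀ ≤ N i) (c₀ : ℝ)
    {M : ℕ → ℕ} (hMj : ∀ j, 1 ≤ M j) (hdivj : ∀ j i, M j ∣ N i) (k : ℕ) (W : Fin (k + 1) → B5TorusCover.UT N → ℝ)
    (a : Fin (k + 1) → ℝ) (wb kk : Fin (k + 1) → ℝ)
    (Rm : (B5TorusCover.UT N × Fin d) → Cp → Cp → ℝ)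
    (blk : B5TorusCover.UT N × Cp → g.Site)
    (blkY : (B5TorusCover.UT N × Fin d) × Cp → g.Site)
    (dd : ℕ)
    (δ₀ α ρ B₀ v₁ v₂ Nn N' : ℝ)
    (S S' : B5TorusCover.Ctr N M₀ → Finset g.Site)
    {G' : Module.End ℝ (B5TorusCover.UT N × Cp → ℝ)}
    (hRm : ∀ b i j, ∑ k, Rm b k i * Rm b k j = if i = j then 1 else 0)
    (hB₀ : 0 ≤ B₀)
    (hδ₀ : 0 ≤ δ₀)
    (hρ : 0 ≤ ρ)
    (hv₁ : 0 ≤ v₁)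
    (hv₂ : 0 ≤ v₂)
    (hN : 0 ≤ Nn)
    (hN' : 0 ≤ N')
    (hαδ : 0 ≤ (1 - α) * δ₀)
    (htri : Triangle254 (toB6 g R H))
    (hrefl : ∀ y : g.Site, g.dist y y = 0)
    (hdnn : ∀ y y' : g.Site, 0 ≤ g.dist y y')
    (hlen : ∀ y : g.Site, 0 ≤ g.len y)
    (h261 : Ineq261 dd (toB6 g R H) δ₀ α)
    (h263 : Ineq263 dd (toB6 g R H) δ₀ α)
    (hsmall : N' * (B₀ * Real.exp (δ₀ * ρ) * ((d + d * Fintype.card Cp : ℝ) * v₁ + (v₂ + (∑ l : Fin (k + 1), (2 * (∑ j ∈ Finset.range l, d * (M j - 1) : ℕ) * (4 * d / (M₀ : ℝ))) * kk l)))) *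
      B6.c1 dd δ₀ α < 1)
    (hS : ∀ i (p : B5TorusCover.UT N × Cp), B5SmoothPartition.hSU N M₀ i p.1 ≠ 0 → blk p ∈ S i)
    (hcnt : ∀ a : g.Site, (∑ i, if a ∈ S i then (1 : ℝ) else 0) ≤ Nn)
    (hcnt' : ∀ a : g.Site, (∑ i, if a ∈ S' i then (1 : ℝ) else 0) ≤ N')
    (hsupp : ∀ i b, B5SmoothPartition.hSU N M₀ i (btgt b) ≠ B5SmoothPartition.hSU N M₀ i (bsrc b) →
      (∀ j, blk (bsrc b, j) ∈ S' i ∧ blk (btgt b, j) ∈ S' i) ∧ ∀ k, blkY (b, k) ∈ S' i)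
    (hadj : ∀ b i k, g.dist (blk (bsrc b, i)) (blkY (b, k)) ≤ ρ ∧ g.dist (blk (btgt b, i)) (blkY (b, k)) ≤ ρ ∧
      g.dist (blkY (b, k)) (blk (bsrc b, i)) ≤ ρ ∧ g.dist (blkY (b, k)) (blk (btgt b, i)) ≤ ρ)
    (hV₁ : ∀ i (a : g.Site), a ∈ S' i → (|c₀| * (4 * d / (M₀ : ℝ))) * ∑ y ∈ (S' i).filter (fun y => g.dist a y ≤ ρ), g.len y ≤ v₁)
    (hV₂ : ∀ i (a : g.Site), a ∈ S' i → (c₀ ^ 2 * (52 * d / (M₀ : ℝ) ^ 2)) * g.len a ^ 2 ≤ v₂)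
    (hW : ∀ l x, |W l x| ≤ wb l) (hkk : ∀ l, 0 ≤ kk l)
    (hk : ∀ l (b : g.Site),
      |a l| * (wb l ^ 2 * (Fintype.card Cp : ℝ) ^ 2 * towerN (fun j => M j ^ d) l) * g.len b ^ 2 ≤ kk l)
    (hnestTop : ∀ p q : B5TorusCover.UT N × Cp,
      towerBlk (torusTower hMj hdivj) k q.1 = towerBlk (torusTower hMj hdivj) k p.1 → blk q = blk p)
    (hS'Q : ∀ i (p : B5TorusCover.UT N × Cp), B5SmoothPartition.hSU N M₀ i p.1 ≠ 0 → blk p ∈ S' i)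
    {Gsq : B5TorusCover.Ctr N M₀ → Module.End ℝ (B5TorusCover.UT N × Cp → ℝ)}
    (h342_1 : ∀ i, HasMajorant (g := toB6 g R H) blk (Gsq i)
      (fun a b => B₀ * g.len a ^ 2 * Real.exp (-(δ₀ * g.dist a b))))
    (h342_2 : ∀ i, HasMajorantHom (g := toB6 g R H) blk blkY (covD bsrc btgt (fun _ : B5TorusCover.UT N × Fin d => c₀) Rm ∘ₗ Gsq i)
      (fun a b => B₀ * g.len a * Real.exp (-(δ₀ * g.dist a b))))
    (hloc : ∀ i, mulOp (B5SmoothPartition.hSU N M₀ i ∘ Prod.fst) * (covDT bsrc btgt (fun _ : B5TorusCover.UT N × Fin d => c₀) Rm ∘ₗ covD bsrc btgt (fun _ : B5TorusCover.UT N × Fin d => c₀) Rm + (levelSum (fun l : Fin (k + 1) => towerBlk (torusTower hMj hdivj) (l : ℕ)) W (fun l => towerTr (torusTower hMj hdivj) Rm (l : ℕ)) a)) * Gsq i *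
      mulOp (B5SmoothPartition.hSU N M₀ i ∘ Prod.fst) = mulOp (B5SmoothPartition.hSU N M₀ i ∘ Prod.fst) * mulOp (B5SmoothPartition.hSU N M₀ i ∘ Prod.fst))
    (hinv : G' * (covDT bsrc btgt (fun _ : B5TorusCover.UT N × Fin d => c₀) Rm ∘ₗ covD bsrc btgt (fun _ : B5TorusCover.UT N × Fin d => c₀) Rm + (levelSum (fun l : Fin (k + 1) => towerBlk (torusTower hMj hdivj) (l : ℕ)) W (fun l => towerTr (torusTower hMj hdivj) Rm (l : ℕ)) a)) = 1) :
    HasMajorant (g := toB6 g R H) blk G'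
      (fun (a b : g.Site) => Nn * B₀ * B6.c1 dd δ₀ α *
        (1 - N' * (B₀ * Real.exp (δ₀ * ρ) * ((d + d * Fintype.card Cp : ℝ) * v₁ + (v₂ + (∑ l : Fin (k + 1), (2 * (∑ j ∈ Finset.range l, d * (M j - 1) : ℕ) * (4 * d / (M₀ : ℝ))) * kk l)))) *
          B6.c1 dd δ₀ α)⁻¹ * g.len a ^ 2 *
        Real.exp (-((1 - α) * δ₀ * g.dist a b))) := by
  have hθQ0 : (0 : ℝ) ≤ 4 * d / (M₀ : ℝ) := by positivity
  have hθQ : ∀ (z : B5TorusCover.Ctr N M₀) (b : B5TorusCover.UT N × Fin d),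
      |B5SmoothPartition.hSU N M₀ z (btgt b) - B5SmoothPartition.hSU N M₀ z (bsrc b)| ≤ 4 * d / (M₀ : ℝ) :=
    fun z b => by simpa only [one_mul, abs_one] using hθ_torus (N := N) hM (1 : ℝ) z b
  have hzero : ∀ (z : B5TorusCover.Ctr N M₀) (p : B5TorusCover.UT N × Cp), blk p ∉ S' z →
      B5SmoothPartition.hSU N M₀ z p.1 = 0 := fun z p hp => by
    by_contra hne
    exact hp (hS'Q z p hne)
  obtain ⟨hQ, hKQ, hlocQ, hrowQ, hcolQ⟩ := commData_towerLevelSum_of_bondBound (g := g) (R := R) (H := H)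
    (torusTower hMj hdivj) Rm hRm k W a wb (fun j => M j ^ d) (fun j => d * (M j - 1)) blk hnestTop hW
    (fun j z => B9Thm37GlueTorusCovPoinc.card_block_le (hMj j) (hdivj j) z)
    (fun j y => B9Thm37GlueTorusCovPoinc.tdepth_le (hMj j) y) ρ (fun b => by rw [hrefl b]; exact hρ) kk hk
    (B5SmoothPartition.hSU N M₀) S' hθQ0 hθQ hzero
  have hκQ : 0 ≤ (∑ l : Fin (k + 1), (2 * (∑ j ∈ Finset.range l, d * (M j - 1) : ℕ) * (4 * d / (M₀ : ℝ))) * kk l) :=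
    Finset.sum_nonneg fun l _ => mul_nonneg (by positivity) (hkk l)
  clear hcolQ
  exact thm37_entry1_of_342_lattice_of_387_sz bsrc btgt (fun _ : B5TorusCover.UT N × Fin d => c₀) Rm _ blk blkY dd d δ₀ α ρ B₀ v₁ v₂ _ Nn N' S S' (B5SmoothPartition.hSU N M₀) (fun _ => |c₀| * (4 * d / (M₀ : ℝ))) (fun _ => c₀ ^ 2 * (52 * d / (M₀ : ℝ) ^ 2)) _ hRm hB₀ hδ₀ hρ hv₁ hv₂ hκQ hN hN' hαδ htri hrefl hdnn hlen h261 h263 hsmall (hh_torus M₀) hS hcnt hcnt' (hθ0_torus M₀ c₀) (hθ_torus hM c₀) (hθ₂0_torus M₀ c₀) (hθ₂_torus hM h2N c₀) hsupp hNs_torus hNt_torus hadj hV₁ hV₂ hKQ hlocQ hrowQ (hsq_torus hM hdiv h2N) h342_1 h342_2 hQ hloc hinv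

/-- **THEOREM 3.7 ⇒ ENTRY 2 OF (3.42) (∇G′), TORUS MODEL OF [3] (1.118), WITH THE TOWER'S MULTI-LEVEL Q′\*aQ′ AND ITS Q-BINDERS DISCHARGED**
= `B9Thm37GlueSz.thm37_entry2_of_342_lattice_of_387_sz` on the torus `UT N` (partition `hSU N M₀`, nearest-neighbour bonds with weight c₀, the ∂h∕Δh sizes
`4|c₀|d∕M₀`, `52c₀²d∕M₀²`, bond counts d, Σ_z h_z² = 1 — `B9Thm37GluePU` §1–§3) at `Qf := Σ_{l≤k} a_lG_lᵀG_l` over the cube-comb tower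
`torusTower` (sides M_j), the Q-binders supplied by `B9Thm37GlueLevelSumOsc.commData_towerLevelSum_of_bondBound` (θ = 4d∕M₀, D_j = d(M_j − 1),
n_j = M_j^d), κ_Q := Σ_l (2(Σ_{j<l} d(M_j − 1))·4d∕M₀)·k_l; newly displayed binders `hW hkk hk hnestTop hS'Q`; every other hypothesis
verbatim from the lineage (NOT asserted). [cite: Balaban1985BackgroundPropagators, Thm 3.7 (3.87)–(3.90) pp.408–410 + (3.42) p.397 + (3.16) p.393; Balaban1984PropagatorsII, (2.40)–(2.44) p.230; Balaban1984PropagatorsI, (1.118) p.36] -/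
theorem thm37_entry2_torusTower [Fintype Cp]
    [DecidableEq Cp]
    {M₀ : ℕ} (hM : 1 ≤ M₀) (hdiv : ∀ i, M₀ ∣ N i) (h2N : ∀ i, 2 * M₀ ≤ N i) (c₀ : ℝ)
    {M : ℕ → ℕ} (hMj : ∀ j, 1 ≤ M j) (hdivj : ∀ j i, M j ∣ N i) (k : ℕ) (W : Fin (k + 1) → B5TorusCover.UT N → ℝ)
    (a : Fin (k + 1) → ℝ) (wb kk : Fin (k + 1) → ℝ)
    (Rm : (B5TorusCover.UT N × Fin d) → Cp → Cp → ℝ)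
    (blk : B5TorusCover.UT N × Cp → g.Site)
    (blkY : (B5TorusCover.UT N × Fin d) × Cp → g.Site)
    (dd : ℕ)
    (δ₀ α ρ B₀ v₁ v₂ κ₄ Nn N' : ℝ)
    (S S' : B5TorusCover.Ctr N M₀ → Finset g.Site)
    {G' : Module.End ℝ (B5TorusCover.UT N × Cp → ℝ)}
    (hRm : ∀ b i j, ∑ k, Rm b k i * Rm b k j = if i = j then 1 else 0)
    (hB₀ : 0 ≤ B₀)
    (hδ₀ : 0 ≤ δ₀)
    (hρ : 0 ≤ ρ)
    (hv₁ : 0 ≤ v₁)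
    (hv₂ : 0 ≤ v₂)
    (hκ₄ : 0 ≤ κ₄)
    (hN : 0 ≤ Nn)
    (hN' : 0 ≤ N')
    (hαδ : 0 ≤ (1 - α) * δ₀)
    (htri : Triangle254 (toB6 g R H))
    (hrefl : ∀ y : g.Site, g.dist y y = 0)
    (hdnn : ∀ y y' : g.Site, 0 ≤ g.dist y y')
    (hlen : ∀ y : g.Site, 0 ≤ g.len y)
    (h261 : Ineq261 dd (toB6 g R H) δ₀ α)
    (h263 : Ineq263 dd (toB6 g R H) δ₀ α)
    (hsmall : N' * (B₀ * Real.exp (δ₀ * ρ) * ((d + d * Fintype.card Cp : ℝ) * v₁ + (v₂ + (∑ l : Fin (k + 1), (2 * (∑ j ∈ Finset.range l, d * (M j - 1) : ℕ) * (4 * d / (M₀ : ℝ))) * kk l)))) *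
      B6.c1 dd δ₀ α < 1)
    (hSY : ∀ i (v : (B5TorusCover.UT N × Fin d) × Cp), B5SmoothPartition.hSU N M₀ i (btgt v.1) ≠ 0 → blkY v ∈ S i)
    (hcnt : ∀ a : g.Site, (∑ i, if a ∈ S i then (1 : ℝ) else 0) ≤ Nn)
    (hcnt' : ∀ a : g.Site, (∑ i, if a ∈ S' i then (1 : ℝ) else 0) ≤ N')
    (hsupp : ∀ i b, B5SmoothPartition.hSU N M₀ i (btgt b) ≠ B5SmoothPartition.hSU N M₀ i (bsrc b) →
      (∀ j, blk (bsrc b, j) ∈ S' i ∧ blk (btgt b, j) ∈ S' i) ∧ ∀ k, blkY (b, k) ∈ S' i)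
    (hadj : ∀ b i k, g.dist (blk (bsrc b, i)) (blkY (b, k)) ≤ ρ ∧ g.dist (blk (btgt b, i)) (blkY (b, k)) ≤ ρ ∧
      g.dist (blkY (b, k)) (blk (bsrc b, i)) ≤ ρ ∧ g.dist (blkY (b, k)) (blk (btgt b, i)) ≤ ρ)
    (hV₁ : ∀ i (a : g.Site), a ∈ S' i → (|c₀| * (4 * d / (M₀ : ℝ))) * ∑ y ∈ (S' i).filter (fun y => g.dist a y ≤ ρ), g.len y ≤ v₁)
    (hV₂ : ∀ i (a : g.Site), a ∈ S' i → (c₀ ^ 2 * (52 * d / (M₀ : ℝ) ^ 2)) * g.len a ^ 2 ≤ v₂)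
    (hV₃ : ∀ i (a : g.Site), a ∈ S' i →
      (|c₀| * (4 * d / (M₀ : ℝ))) * ∑ y ∈ (S' i).filter (fun y => g.dist a y ≤ ρ), g.len y ^ 2 ≤ κ₄ * g.len a)
    (hW : ∀ l x, |W l x| ≤ wb l) (hkk : ∀ l, 0 ≤ kk l)
    (hk : ∀ l (b : g.Site),
      |a l| * (wb l ^ 2 * (Fintype.card Cp : ℝ) ^ 2 * towerN (fun j => M j ^ d) l) * g.len b ^ 2 ≤ kk l)
    (hnestTop : ∀ p q : B5TorusCover.UT N × Cp,
      towerBlk (torusTower hMj hdivj) k q.1 = towerBlk (torusTower hMj hdivj) k p.1 → blk q = blk p)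
    (hS'Q : ∀ i (p : B5TorusCover.UT N × Cp), B5SmoothPartition.hSU N M₀ i p.1 ≠ 0 → blk p ∈ S' i)
    {Gsq : B5TorusCover.Ctr N M₀ → Module.End ℝ (B5TorusCover.UT N × Cp → ℝ)}
    (h342_1 : ∀ i, HasMajorant (g := toB6 g R H) blk (Gsq i)
      (fun a b => B₀ * g.len a ^ 2 * Real.exp (-(δ₀ * g.dist a b))))
    (h342_2 : ∀ i, HasMajorantHom (g := toB6 g R H) blk blkY (covD bsrc btgt (fun _ : B5TorusCover.UT N × Fin d => c₀) Rm ∘ₗ Gsq i)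
      (fun a b => B₀ * g.len a * Real.exp (-(δ₀ * g.dist a b))))
    (hloc : ∀ i, mulOp (B5SmoothPartition.hSU N M₀ i ∘ Prod.fst) * (covDT bsrc btgt (fun _ : B5TorusCover.UT N × Fin d => c₀) Rm ∘ₗ covD bsrc btgt (fun _ : B5TorusCover.UT N × Fin d => c₀) Rm + (levelSum (fun l : Fin (k + 1) => towerBlk (torusTower hMj hdivj) (l : ℕ)) W (fun l => towerTr (torusTower hMj hdivj) Rm (l : ℕ)) a)) * Gsq i *
      mulOp (B5SmoothPartition.hSU N M₀ i ∘ Prod.fst) = mulOp (B5SmoothPartition.hSU N M₀ i ∘ Prod.fst) * mulOp (B5SmoothPartition.hSU N M₀ i ∘ Prod.fst))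
    (hinv : G' * (covDT bsrc btgt (fun _ : B5TorusCover.UT N × Fin d => c₀) Rm ∘ₗ covD bsrc btgt (fun _ : B5TorusCover.UT N × Fin d => c₀) Rm + (levelSum (fun l : Fin (k + 1) => towerBlk (torusTower hMj hdivj) (l : ℕ)) W (fun l => towerTr (torusTower hMj hdivj) Rm (l : ℕ)) a)) = 1) :
    HasMajorantHom (g := toB6 g R H) blk blkY (covD bsrc btgt (fun _ : B5TorusCover.UT N × Fin d => c₀) Rm ∘ₗ G')
      (fun (a b : g.Site) => B₀ * (Nn + N' * Real.exp (δ₀ * ρ) * κ₄) * B6.c1 dd δ₀ α *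
        (1 - N' * (B₀ * Real.exp (δ₀ * ρ) * ((d + d * Fintype.card Cp : ℝ) * v₁ + (v₂ + (∑ l : Fin (k + 1), (2 * (∑ j ∈ Finset.range l, d * (M j - 1) : ℕ) * (4 * d / (M₀ : ℝ))) * kk l)))) *
          B6.c1 dd δ₀ α)⁻¹ * g.len a *
        Real.exp (-((1 - α) * δ₀ * g.dist a b))) := by
  have hθQ0 : (0 : ℝ) ≤ 4 * d / (M₀ : ℝ) := by positivity
  have hθQ : ∀ (z : B5TorusCover.Ctr N M₀) (b : B5TorusCover.UT N × Fin d),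
      |B5SmoothPartition.hSU N M₀ z (btgt b) - B5SmoothPartition.hSU N M₀ z (bsrc b)| ≤ 4 * d / (M₀ : ℝ) :=
    fun z b => by simpa only [one_mul, abs_one] using hθ_torus (N := N) hM (1 : ℝ) z b
  have hzero : ∀ (z : B5TorusCover.Ctr N M₀) (p : B5TorusCover.UT N × Cp), blk p ∉ S' z →
      B5SmoothPartition.hSU N M₀ z p.1 = 0 := fun z p hp => by
    by_contra hne
    exact hp (hS'Q z p hne)
  obtain ⟨hQ, hKQ, hlocQ, hrowQ, hcolQ⟩ := commData_towerLevelSum_of_bondBound (g := g) (R := R) (H := H)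
    (torusTower hMj hdivj) Rm hRm k W a wb (fun j => M j ^ d) (fun j => d * (M j - 1)) blk hnestTop hW
    (fun j z => B9Thm37GlueTorusCovPoinc.card_block_le (hMj j) (hdivj j) z)
    (fun j y => B9Thm37GlueTorusCovPoinc.tdepth_le (hMj j) y) ρ (fun b => by rw [hrefl b]; exact hρ) kk hk
    (B5SmoothPartition.hSU N M₀) S' hθQ0 hθQ hzero
  have hκQ : 0 ≤ (∑ l : Fin (k + 1), (2 * (∑ j ∈ Finset.range l, d * (M j - 1) : ℕ) * (4 * d / (M₀ : ℝ))) * kk l) :=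
    Finset.sum_nonneg fun l _ => mul_nonneg (by positivity) (hkk l)
  clear hcolQ
  exact thm37_entry2_of_342_lattice_of_387_sz bsrc btgt (fun _ : B5TorusCover.UT N × Fin d => c₀) Rm _ blk blkY dd d δ₀ α ρ B₀ v₁ v₂ _ κ₄ Nn N' S S' (B5SmoothPartition.hSU N M₀) (fun _ => |c₀| * (4 * d / (M₀ : ℝ))) (fun _ => c₀ ^ 2 * (52 * d / (M₀ : ℝ) ^ 2)) _ hRm hB₀ hδ₀ hρ hv₁ hv₂ hκQ hκ₄ hN hN' hαδ htri hrefl hdnn hlen h261 h263 hsmall (hh_torus M₀) hSY hcnt hcnt' (hθ0_torus M₀ c₀) (hθ_torus hM c₀) (hθ₂0_torus M₀ c₀) (hθ₂_torus hM h2N c₀) hsupp hNs_torus hNt_torus hadj hV₁ hV₂ hV₃ hKQ hlocQ hrowQ (hsq_torus hM hdiv h2N) h342_1 h342_2 hQ hloc hinv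

/-- **THEOREM 3.7 ⇒ ENTRY 3 OF (3.42) (G′∇*), TORUS MODEL OF [3] (1.118), WITH THE TOWER'S MULTI-LEVEL Q′\*aQ′ AND ITS Q-BINDERS DISCHARGED**
= `B9Thm37GlueSz.thm37_entry3_of_342_lattice_of_387_sz` on the torus `UT N` (partition `hSU N M₀`, nearest-neighbour bonds with weight c₀, the ∂h∕Δh sizes
`4|c₀|d∕M₀`, `52c₀²d∕M₀²`, bond counts d, Σ_z h_z² = 1 — `B9Thm37GluePU` §1–§3) at `Qf := Σ_{l≤k} a_lG_lᵀG_l` over the cube-comb tower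
`torusTower` (sides M_j), the Q-binders supplied by `B9Thm37GlueLevelSumOsc.commData_towerLevelSum_of_bondBound` (θ = 4d∕M₀, D_j = d(M_j − 1),
n_j = M_j^d), κ_Q := Σ_l (2(Σ_{j<l} d(M_j − 1))·4d∕M₀)·k_l; newly displayed binders `hW hkk hk hnestTop hS'Q`; every other hypothesis
verbatim from the lineage (NOT asserted). [cite: Balaban1985BackgroundPropagators, Thm 3.7 (3.87)–(3.90) pp.408–410 + (3.42) p.397 + (3.16) p.393; Balaban1984PropagatorsII, (2.40)–(2.44) p.230; Balaban1984PropagatorsI, (1.118) p.36] -/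
theorem thm37_entry3_torusTower [Fintype Cp]
    [DecidableEq Cp]
    (blk : B5TorusCover.UT N × Cp → g.Site)
    (blkY : (B5TorusCover.UT N × Fin d) × Cp → g.Site)
    {M₀ : ℕ} (hM : 1 ≤ M₀) (hdiv : ∀ i, M₀ ∣ N i) (h2N : ∀ i, 2 * M₀ ≤ N i) (c₀ : ℝ)
    {M : ℕ → ℕ} (hMj : ∀ j, 1 ≤ M j) (hdivj : ∀ j i, M j ∣ N i) (k : ℕ) (W : Fin (k + 1) → B5TorusCover.UT N → ℝ)
    (a : Fin (k + 1) → ℝ) (wb kk : Fin (k + 1) → ℝ)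
    (Rm : (B5TorusCover.UT N × Fin d) → Cp → Cp → ℝ)
    (dd : ℕ)
    (δ₀ α ρ B₀ w₁ v₂ Cℓ Nn N' : ℝ)
    (S S' : B5TorusCover.Ctr N M₀ → Finset g.Site)
    {G' : Module.End ℝ (B5TorusCover.UT N × Cp → ℝ)}
    (hRm : ∀ b i j, ∑ k, Rm b k i * Rm b k j = if i = j then 1 else 0)
    (hB₀ : 0 ≤ B₀)
    (hδ₀ : 0 ≤ δ₀)
    (hρ : 0 ≤ ρ)
    (hw₁ : 0 ≤ w₁)
    (hv₂ : 0 ≤ v₂)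
    (hCℓ : 0 ≤ Cℓ)
    (hN : 0 ≤ Nn)
    (hN' : 0 ≤ N')
    (hαδ : 0 ≤ α * δ₀)
    (hαδ2 : 0 ≤ (1 - 2 * α) * δ₀)
    (htri : Triangle254 (toB6 g R H))
    (hrefl : ∀ y : g.Site, g.dist y y = 0)
    (hsym : ∀ y y' : g.Site, g.dist y y' = g.dist y' y)
    (hdnn : ∀ y y' : g.Site, 0 ≤ g.dist y y')
    (hlenpos : ∀ y : g.Site, 0 < g.len y)
    (h261 : Ineq261 dd (toB6 g R H) δ₀ α)
    (h263 : Ineq263 dd (toB6 g R H) δ₀ α)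
    (hsmall : N' * (B₀ * Real.exp (δ₀ * ρ) * ((1 + Fintype.card Cp : ℝ) * w₁ + Cℓ * (v₂ + (∑ l : Fin (k + 1), (2 * (∑ j ∈ Finset.range l, d * (M j - 1) : ℕ) * (4 * d / (M₀ : ℝ))) * kk l)))) *
      B6.c1 dd δ₀ α < 1)
    (hS : ∀ i (p : B5TorusCover.UT N × Cp), B5SmoothPartition.hSU N M₀ i p.1 ≠ 0 → blk p ∈ S i)
    (hcnt : ∀ a : g.Site, (∑ i, if a ∈ S i then (1 : ℝ) else 0) ≤ Nn)
    (hcnt' : ∀ b : g.Site, (∑ i, if b ∈ S' i then (1 : ℝ) else 0) ≤ N')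
    (hcomp : ∀ i (a b : g.Site), a ∈ S i → b ∈ S' i → g.len a ≤ Cℓ * g.len b)
    (hsupp : ∀ i b, B5SmoothPartition.hSU N M₀ i (btgt b) ≠ B5SmoothPartition.hSU N M₀ i (bsrc b) →
      (∀ j, blk (bsrc b, j) ∈ S' i ∧ blk (btgt b, j) ∈ S' i) ∧ ∀ k, blkY (b, k) ∈ S' i)
    (hadj : ∀ b i k, g.dist (blk (bsrc b, i)) (blkY (b, k)) ≤ ρ ∧ g.dist (blk (btgt b, i)) (blkY (b, k)) ≤ ρ ∧
      g.dist (blkY (b, k)) (blk (bsrc b, i)) ≤ ρ ∧ g.dist (blkY (b, k)) (blk (btgt b, i)) ≤ ρ)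
    (hC₁ : ∀ i (b : g.Site), b ∈ S' i →
      (|c₀| * (4 * d / (M₀ : ℝ))) * ((S' i).filter (fun y => g.dist y b ≤ ρ)).card * g.len b ≤ w₁)
    (hV₂ : ∀ i (a : g.Site), a ∈ S' i → (c₀ ^ 2 * (52 * d / (M₀ : ℝ) ^ 2)) * g.len a ^ 2 ≤ v₂)
    (hW : ∀ l x, |W l x| ≤ wb l) (hkk : ∀ l, 0 ≤ kk l)
    (hk : ∀ l (b : g.Site),
      |a l| * (wb l ^ 2 * (Fintype.card Cp : ℝ) ^ 2 * towerN (fun j => M j ^ d) l) * g.len b ^ 2 ≤ kk l)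
    (hnestTop : ∀ p q : B5TorusCover.UT N × Cp,
      towerBlk (torusTower hMj hdivj) k q.1 = towerBlk (torusTower hMj hdivj) k p.1 → blk q = blk p)
    (hS'Q : ∀ i (p : B5TorusCover.UT N × Cp), B5SmoothPartition.hSU N M₀ i p.1 ≠ 0 → blk p ∈ S' i)
    {Gsq : B5TorusCover.Ctr N M₀ → Module.End ℝ (B5TorusCover.UT N × Cp → ℝ)}
    (h342_1 : ∀ i, HasMajorant (g := toB6 g R H) blk (Gsq i)
      (fun a b => B₀ * g.len a ^ 2 * Real.exp (-(δ₀ * g.dist a b))))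
    (h342_3 : ∀ i, HasMajorantHom (g := toB6 g R H) blkY blk (Gsq i ∘ₗ covDT bsrc btgt (fun _ : B5TorusCover.UT N × Fin d => c₀) Rm)
      (fun a b => B₀ * g.len a * Real.exp (-(δ₀ * g.dist a b))))
    (hG : ∀ i, IsTransposePair (Gsq i) (Gsq i))
    (hloc : ∀ i, mulOp (B5SmoothPartition.hSU N M₀ i ∘ Prod.fst) * (covDT bsrc btgt (fun _ : B5TorusCover.UT N × Fin d => c₀) Rm ∘ₗ covD bsrc btgt (fun _ : B5TorusCover.UT N × Fin d => c₀) Rm + (levelSum (fun l : Fin (k + 1) => towerBlk (torusTower hMj hdivj) (l : ℕ)) W (fun l => towerTr (torusTower hMj hdivj) Rm (l : ℕ)) a)) * Gsq i *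
      mulOp (B5SmoothPartition.hSU N M₀ i ∘ Prod.fst) = mulOp (B5SmoothPartition.hSU N M₀ i ∘ Prod.fst) * mulOp (B5SmoothPartition.hSU N M₀ i ∘ Prod.fst))
    (hinv : G' * (covDT bsrc btgt (fun _ : B5TorusCover.UT N × Fin d => c₀) Rm ∘ₗ covD bsrc btgt (fun _ : B5TorusCover.UT N × Fin d => c₀) Rm + (levelSum (fun l : Fin (k + 1) => towerBlk (torusTower hMj hdivj) (l : ℕ)) W (fun l => towerTr (torusTower hMj hdivj) Rm (l : ℕ)) a)) = 1) :
    HasMajorantHom (g := toB6 g R H) blkY blk (G' ∘ₗ covDT bsrc btgt (fun _ : B5TorusCover.UT N × Fin d => c₀) Rm)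
      (fun (a b : g.Site) => B₀ * (Nn + N' * Real.exp (δ₀ * ρ) * Cℓ * (d * w₁)) * B6.c1 dd δ₀ α *
        (1 - N' * (B₀ * Real.exp (δ₀ * ρ) * ((1 + Fintype.card Cp : ℝ) * w₁ + Cℓ * (v₂ + (∑ l : Fin (k + 1), (2 * (∑ j ∈ Finset.range l, d * (M j - 1) : ℕ) * (4 * d / (M₀ : ℝ))) * kk l)))) *
          B6.c1 dd δ₀ α)⁻¹ * g.len a *
        Real.exp (-((1 - 2 * α) * δ₀ * g.dist a b))) := by
  have hθQ0 : (0 : ℝ) ≤ 4 * d / (M₀ : ℝ) := by positivity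
  have hθQ : ∀ (z : B5TorusCover.Ctr N M₀) (b : B5TorusCover.UT N × Fin d),
      |B5SmoothPartition.hSU N M₀ z (btgt b) - B5SmoothPartition.hSU N M₀ z (bsrc b)| ≤ 4 * d / (M₀ : ℝ) :=
    fun z b => by simpa only [one_mul, abs_one] using hθ_torus (N := N) hM (1 : ℝ) z b
  have hzero : ∀ (z : B5TorusCover.Ctr N M₀) (p : B5TorusCover.UT N × Cp), blk p ∉ S' z →
      B5SmoothPartition.hSU N M₀ z p.1 = 0 := fun z p hp => by
    by_contra hne
    exact hp (hS'Q z p hne)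
  obtain ⟨hQ, hKQ, hlocQ, hrowQ, hcolQ⟩ := commData_towerLevelSum_of_bondBound (g := g) (R := R) (H := H)
    (torusTower hMj hdivj) Rm hRm k W a wb (fun j => M j ^ d) (fun j => d * (M j - 1)) blk hnestTop hW
    (fun j z => B9Thm37GlueTorusCovPoinc.card_block_le (hMj j) (hdivj j) z)
    (fun j y => B9Thm37GlueTorusCovPoinc.tdepth_le (hMj j) y) ρ (fun b => by rw [hrefl b]; exact hρ) kk hk
    (B5SmoothPartition.hSU N M₀) S' hθQ0 hθQ hzero
  have hκQ : 0 ≤ (∑ l : Fin (k + 1), (2 * (∑ j ∈ Finset.range l, d * (M j - 1) : ℕ) * (4 * d / (M₀ : ℝ))) * kk l) :=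
    Finset.sum_nonneg fun l _ => mul_nonneg (by positivity) (hkk l)
  clear hrowQ
  exact thm37_entry3_of_342_lattice_of_387_sz blk blkY bsrc btgt (fun _ : B5TorusCover.UT N × Fin d => c₀) Rm _ dd d δ₀ α ρ B₀ w₁ v₂ _ Cℓ Nn N' S S' (B5SmoothPartition.hSU N M₀) (fun _ => |c₀| * (4 * d / (M₀ : ℝ))) (fun _ => c₀ ^ 2 * (52 * d / (M₀ : ℝ) ^ 2)) _ hRm hB₀ hδ₀ hρ hw₁ hv₂ hκQ hCℓ hN hN' hαδ hαδ2 htri hrefl hsym hdnn hlenpos h261 h263 hsmall (hh_torus M₀) hS hcnt hcnt' hcomp (hθ0_torus M₀ c₀) (hθ_torus hM c₀) (hθ₂0_torus M₀ c₀) (hθ₂_torus hM h2N c₀) hsupp hNs_torus hadj hC₁ hV₂ hKQ hlocQ hcolQ (hsq_torus hM hdiv h2N) h342_1 h342_3 hQ (isTransposePair_levelSum _ _ _ _) hG hloc hinv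

end

end Literature.MathematicalPhysics.QuantumFieldTheory.Balaban1983to89.B9Thm37GlueTowerEntriesTorus
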